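import Summits.QuantumFields.YangMills.Theorems.F4SubCurvatureDoorShortRootRigidityTorusLadder
import Summits.QuantumFields.YangMills.Theorems.F4SubCurvatureDoorShortRootRigidityTrigonalFinish
import Literature.Algebra.Polynomial.FischerHarmonicNormalForm
import Literature.Analysis.Calculus.MvPolynomialFDeriv
import Mathlib
import HarnessLib

/-!
# TorusReduction, part (TR1): Fischer bookkeeping on `ℝ[x₁,x₂,x₃]` for the three-dimensional theorem behind `NoBadModes`

Crux ⟨stmt-QuantumFields-23035⟩ `F4SubCurvatureDoor.ShortRootRigidity`, stub `:146 stub_oddModeRigidity`, piece `TorusReduction`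
(`Cruxes/ShortRootRigidity/Lines/odd_mode_split.lean`).

This file carries the PRELIMINARIES of the 3D theorem (proved in `…TorusSlice3`): the indexed harmonic Fischer expansion
(`exists_fischer`), the transfer of symmetries to Fischer components (`fischer_component_fixed`, by uniqueness), `Harm₂(ℝ³)^{O_h} = 0`
(`harm_two_eq_zero`), translation invariance of `D`-killed polynomials (`bind₁_Pm_eq_self`), and the `η'`-form of the ladder's harmonic
correction.  For orientation, the theorem they serve:

THE 3D THEOREM (`slice_eq_zero`, next file).  Let `h₀ ∈ ℝ[x₁,x₂,x₃]` be homogeneous of EVEN degree `2K ≥ 2` and `O_h`-invariant (`OhInvariant`), let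
`σ = Rf` be the reflection in the plane `(1,1,1)^⊥`, `a := h₀ + h₀∘σ`, `s = Σxᵢ`, `D = Σ∂ᵢ`, and suppose the PDE `s·Δa + D a = 0` (this is what
the support condition `EvenPartSliceInvariant` of a `W(B₄)`-invariant harmonic polynomial on `ℝ⁴` says about its `x₀ = 0` slice).  Then
`h₀ = 0`, GIVEN (i) trigonal injectivity in the E-free rational form `TrigonalInjectivityQ s` for all `s ≥ 1` (tree: w3 g38) and (ii) the
planar lemma `TransverseVanishing`: a harmonic homogeneous polynomial of degree `n ≥ 1`, `3 ∤ n`, killed by `D` and `S₃`-symmetric is `0`.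

PROOF.  Harmonic Fischer expansion `a = Σⱼ ρʲ ψⱼ` (`ψⱼ` harmonic homogeneous of degree `2K − 2j`; existence from the Literature normal form,
uniqueness = `eq_zero_of_sum_rho_pow_mul_eq_zero` of the ladder file), with `ψⱼ = ψ'ⱼ + ψ'ⱼ∘σ` for the components `ψ'ⱼ` of `h₀`, which inherit
`O_h`-invariance (uniqueness).  By the ladder identity the PDE is `Σⱼ ρʲ Qⱼ = 0` with harmonic `Qⱼ = c₁(j+1)·η'(ψⱼ₊₁) + κⱼ·Dψⱼ`, `κⱼ > 0`,
so every `Qⱼ = 0`; hence `ψⱼ₊₁ = 0 ⇒ Dψⱼ = 0`.  Upward induction in the degree: `ψ'` of degree `2` vanishes (`Harm₂^{O_h} = 0`); a `D`-killed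
`ψⱼ` of degree `n` vanishes by `TransverseVanishing` if `3 ∤ n`, and if `n = 6s` then `ψ'ⱼ∘Pm = ½ψⱼ` is harmonic so `ψ'ⱼ = 0` by
`TrigonalInjectivityQ s`; finally the degree-`0` rung gives `sψ_K = 0`.  So `a = 0`, i.e. `h₀` is `σ`-odd, and an `O_h`-invariant `σ`-odd
polynomial is odd under two diagonal reflections, hence `0` (✓`eq_zero_of_odd_under_two_diagonal_reflections`).

Mathlib + tree only; no `sorry`; no new definitions.  HONEST LABEL: the algebraic core of ONE piece (`TorusReduction`) of the OPEN stub `:146`;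
`AnalyticHalf`, `:146`, ⟨23035⟩, ⟨23125⟩, R2d and the Yang–Mills mass gap remain OPEN; no summit is proved by a line.
LEAD seat `ym-line-sfw-p2` g76 (cell ym-idea-1, free hands).
-/

noncomputable section

open MvPolynomial
open scoped BigOperators

namespace Summit.QuantumFields.YangMills.Theorems.F4SubCurvatureDoorTorus

open Literature.Analysis.Calculus.MvPoly (lap rho lap_add lap_smul lap_zero lap_rho_mul isHomogeneous_lap isHomogeneous_rho
  lap_eq_zero_of_isHomogeneous_le_one toFun hasFDerivAt_toFun derivCLM_apply)
open Literature.Algebra.Polynomial (linSubst eval_bind₁_linSubst pderiv_bind₁_linSubst laplacian_bind₁_linSubst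
  isHomogeneous_bind₁_linSubst pderiv_pderiv_comm)
open Summit.QuantumFields.YangMills.Theorems.F4SubCurvatureDoorTrigonalLine (P3 Pm Rf J3 flipMat OhInvariant TrigonalInjectivityQ
  Rf_mulVec Pm_mulVec Rf_mulVec_eq_σ₁ σ₂_eq_conj)
open Summit.QuantumFields.YangMills.Theorems.F4SubCurvatureDoorTwoReflections (σ₁ σ₂ eq_zero_of_odd_under_two_diagonal_reflections)

/-! ## Harmonic Fischer expansion: existence in the indexed form `f = Σ_{j ≤ L/2} ρʲ ψⱼ` -/

/-- The tree's `lap` on `P3` is the Literature normal form's `Σᵢ ∂ᵢ²`. -/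
theorem lap_eq_sum (p : P3) : lap p = ∑ i, pderiv i (pderiv i p) := rfl

/-- The tree's `rho` on `P3` is `Σᵢ Xᵢ²`. -/
theorem rho_eq_sum : (rho : P3) = ∑ i, X i ^ 2 := rfl

/-- **Indexed harmonic Fischer expansion**: a homogeneous `f` of degree `L` is `Σ_{j < L/2+1} ρʲ ψⱼ` with `ψⱼ` harmonic homogeneous of degree
`L − 2j` (and we may take `ψⱼ = 0` for `j > L/2`). -/
theorem exists_fischer (L : ℕ) (f : P3) (hf : f.IsHomogeneous L) :
    ∃ ψ : ℕ → P3, (∀ j, (ψ j).IsHomogeneous (L - 2 * j)) ∧ (∀ j, lap (ψ j) = 0) ∧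
      f = ∑ j ∈ Finset.range (L / 2 + 1), rho ^ j * ψ j := by
  induction L using Nat.strong_induction_on generalizing f with
  | _ L ih =>
    by_cases hL : 2 ≤ L
    · obtain ⟨h, c, hh, hΔ, hc, hfhc⟩ :=
        Literature.Algebra.Polynomial.FischerDecomposition.exists_harmonic_add_sum_sq_mul_of_isHomogeneous hf
      obtain ⟨ψ', hhom', hharm', hc'⟩ := ih (L - 2) (by omega) c hc
      refine ⟨fun j => Nat.casesOn j h fun i => ψ' i, ?_, ?_, ?_⟩
      · intro j
        rcases j with _ | i
        · simpa using hh
        · have := hhom' i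
          simp only
          rwa [show L - 2 - 2 * i = L - 2 * (i + 1) by omega] at this
      · intro j
        rcases j with _ | i
        · exact hΔ
        · exact hharm' i
      · rw [show L / 2 + 1 = (L - 2) / 2 + 1 + 1 by omega, Finset.sum_range_succ', pow_zero, one_mul, hfhc, hc', ← rho_eq_sum,
          Finset.mul_sum, add_comm]
        refine congrArg (· + h) (Finset.sum_congr rfl fun i _ => ?_)
        simp only [pow_succ]
        ring
    · refine ⟨fun j => Nat.casesOn j f fun _ => 0, ?_, ?_, ?_⟩
      · intro j
        rcases j with _ | i
        · simpa using hf
        · exact isHomogeneous_zero _ _ _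
      · intro j
        rcases j with _ | i
        · exact lap_eq_zero_of_isHomogeneous_le_one hf (by omega)
        · exact lap_zero
      · rw [show L / 2 + 1 = 0 + 1 by omega, Finset.sum_range_one, pow_zero, one_mul]
        rfl

/-! ## Orthogonal substitutions fixing `ρ` act on the Fischer components -/

/-- `Rf` has orthonormal rows. -/
theorem Rf_mul_transpose : Rf * Rf.transpose = 1 := by
  ext i j
  fin_cases i <;> fin_cases j <;>
    simp [Rf, J3, Matrix.mul_apply, Matrix.transpose_apply, Fin.sum_univ_three, Matrix.one_apply, Matrix.sub_apply] <;> norm_num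

/-- The sign flips have orthonormal rows. -/
theorem flipMat_mul_transpose (i : Fin 3) : flipMat i * (flipMat i).transpose = 1 := by
  ext a b
  fin_cases i <;> fin_cases a <;> fin_cases b <;> simp [flipMat, Matrix.mul_apply, Matrix.diagonal]

/-- The sign flip of coordinate `i`, as a function. -/
theorem flipMat_mulVec (i : Fin 3) (x : Fin 3 → ℝ) : (flipMat i).mulVec x = fun j => if j = i then -x j else x j := by
  ext j
  simp only [flipMat, Matrix.mulVec_diagonal]
  split_ifs <;> ring

/-- `ρ∘σ = ρ`. -/
theorem bind₁_Rf_rho : bind₁ (linSubst Rf) (rho : P3) = rho := by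
  refine MvPolynomial.funext fun x => ?_
  rw [eval_bind₁_linSubst, Rf_mulVec]
  simp [rho_eq_sum, Fin.sum_univ_three]
  ring

/-- `ρ` is invariant under the sign flips. -/
theorem bind₁_flip_rho (i : Fin 3) : bind₁ (linSubst (flipMat i)) (rho : P3) = rho := by
  refine MvPolynomial.funext fun x => ?_
  rw [eval_bind₁_linSubst, flipMat_mulVec]
  fin_cases i <;> simp [rho_eq_sum, Fin.sum_univ_three]

/-- `ρ` is invariant under coordinate permutations. -/
theorem rename_rho (σ : Equiv.Perm (Fin 3)) : rename σ (rho : P3) = rho := by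
  simp only [rho_eq_sum, map_sum, map_pow, rename_X]
  exact Equiv.sum_comp σ (fun i => (X i : P3) ^ 2)

/-- `Δ` commutes with coordinate permutations. -/
theorem lap_rename (σ : Equiv.Perm (Fin 3)) (p : P3) : lap (rename σ p) = rename σ (lap p) := by
  rw [lap_eq_sum, lap_eq_sum, map_sum]
  rw [← Equiv.sum_comp σ (fun i => pderiv i (pderiv i (rename σ p)))]
  refine Finset.sum_congr rfl fun i _ => ?_
  rw [pderiv_rename σ.injective, pderiv_rename σ.injective]

/-- **Invariance transfer.**  An algebra endomorphism `g` of `P3` fixing `ρ`, commuting with `Δ` and preserving degrees acts trivially on the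
Fischer components of any `g`-fixed polynomial (uniqueness of the expansion). -/
theorem fischer_component_fixed (g : P3 →ₐ[ℝ] P3) (hgρ : g rho = rho) (hgΔ : ∀ p, lap (g p) = g (lap p))
    (hgh : ∀ (p : P3) (n : ℕ), p.IsHomogeneous n → (g p).IsHomogeneous n)
    (ψ : ℕ → P3) (d : ℕ → ℕ) (hhom : ∀ j, (ψ j).IsHomogeneous (d j)) (hharm : ∀ j, lap (ψ j) = 0) (K : ℕ)
    (hfix : g (∑ j ∈ Finset.range (K + 1), rho ^ j * ψ j) = ∑ j ∈ Finset.range (K + 1), rho ^ j * ψ j) :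
    ∀ j ≤ K, g (ψ j) = ψ j := by
  have hsum : ∑ j ∈ Finset.range (K + 1), rho ^ j * (g (ψ j) - ψ j) = 0 := by
    rw [map_sum] at hfix
    simp_rw [map_mul, map_pow, hgρ] at hfix
    simp_rw [mul_sub, Finset.sum_sub_distrib, hfix, sub_self]
  intro j hj
  have h := eq_zero_of_sum_rho_pow_mul_eq_zero (fun j => g (ψ j) - ψ j) d
    (fun j => (hgh _ _ (hhom j)).sub (hhom j))
    (fun j => by
      rw [show ∀ p q : P3, lap (p - q) = lap p - lap q from
        Summit.QuantumFields.YangMills.Theorems.F4SubCurvatureDoorTrigonalLine.lap_sub, hgΔ, hharm, map_zero, sub_zero])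
    K hsum j hj
  exact sub_eq_zero.mp h

/-! ## The degree-two component: `Harm₂^{O_h} = 0` -/

/-- A homogeneous polynomial of degree `0` is a constant. -/
theorem eq_C_of_isHomogeneous_zero {p : P3} (hp : p.IsHomogeneous 0) : p = C (coeff 0 p) := by
  have := hp.totalDegree_le
  exact (totalDegree_eq_zero_iff_eq_C).mp (Nat.le_zero.mp this)

/-- **`Harm₂(ℝ³)^{O_h} = 0`**: an `O_h`-invariant harmonic homogeneous quadratic polynomial vanishes (the flips kill the mixed second
derivatives, the permutations equalise the pure ones, harmonicity kills their sum; Euler's identity twice). -/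
theorem harm_two_eq_zero (Y : P3) (hY : Y.IsHomogeneous 2) (hharm : lap Y = 0) (hO : OhInvariant Y) : Y = 0 := by
  -- second derivatives are constants
  have hc : ∀ j k, pderiv k (pderiv j Y) = C (coeff 0 (pderiv k (pderiv j Y))) := fun j k =>
    eq_C_of_isHomogeneous_zero (by simpa using (hY.pderiv (i := j)).pderiv (i := k))
  -- first derivatives transform under the flips: ∂ⱼY = F_jj · (∂ⱼY)∘F
  have hflip1 : ∀ i j, pderiv j Y = C (flipMat i j j) * bind₁ (linSubst (flipMat i)) (pderiv j Y) := by
    intro i j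
    conv_lhs => rw [← hO.2 i]
    rw [pderiv_bind₁_linSubst, Finset.sum_eq_single j]
    · intro a _ ha; simp [flipMat, Matrix.diagonal_apply_ne _ ha]
    · intro h; exact absurd (Finset.mem_univ j) h
  -- mixed second derivatives vanish
  have hmixed : ∀ j k, j ≠ k → pderiv k (pderiv j Y) = 0 := by
    intro j k hjk
    have h1 := congrArg (pderiv k) (hflip1 j j)
    rw [pderiv_C_mul, pderiv_bind₁_linSubst, Finset.sum_eq_single k, hc j k, bind₁_C_right] at h1
    · have hjj : flipMat j j j = -1 := by simp [flipMat]
      have hkk : flipMat j k k = 1 := by simp [flipMat, Matrix.diagonal_apply_eq, Ne.symm hjk]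
      rw [hjj, hkk, map_one, one_mul, map_neg, map_one, neg_one_mul] at h1
      -- `h1 : C c = -C c`
      rw [hc j k]
      have h2 : (2 : ℝ) • C (coeff 0 (pderiv k (pderiv j Y))) = (0 : P3) := by
        rw [two_smul]; nth_rewrite 1 [h1]; rw [neg_add_cancel]
      exact (smul_eq_zero.mp h2).resolve_left two_ne_zero
    · intro a _ ha; simp [flipMat, Matrix.diagonal_apply_ne _ ha]
    · intro h; exact absurd (Finset.mem_univ k) h
  -- pure second derivatives agree
  have hpure : ∀ i, pderiv i (pderiv i Y) = pderiv 0 (pderiv 0 Y) := by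
    intro i
    have h := hO.1 (Equiv.swap 0 i)
    have h1 : pderiv (Equiv.swap 0 i 0) (pderiv (Equiv.swap 0 i 0) (rename (Equiv.swap 0 i) Y)) =
        rename (Equiv.swap 0 i) (pderiv 0 (pderiv 0 Y)) := by
      rw [pderiv_rename (Equiv.swap 0 i).injective, pderiv_rename (Equiv.swap 0 i).injective]
    rw [h, Equiv.swap_apply_left, hc 0 0, rename_C] at h1
    rw [h1, ← hc 0 0]
  -- harmonicity: the common value is zero
  have hdiag : ∀ i, pderiv i (pderiv i Y) = 0 := by
    have h3 : (3 : ℝ) • pderiv 0 (pderiv 0 Y) = 0 := by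
      rw [← hharm, lap_eq_sum, Fin.sum_univ_three, hpure 0, hpure 1, hpure 2]
      rw [show (3 : ℝ) = 1 + 1 + 1 by norm_num, add_smul, add_smul, one_smul]
    have h0 : pderiv 0 (pderiv 0 Y) = 0 := (smul_eq_zero.mp h3).resolve_left (by norm_num)
    intro i; rw [hpure i, h0]
  -- all second derivatives vanish, hence all first derivatives (Euler in degree 1), hence `Y` (Euler in degree 2)
  have hsecond : ∀ j k, pderiv k (pderiv j Y) = 0 := by
    intro j k
    by_cases hjk : j = k
    · subst hjk; exact hdiag j
    · exact hmixed j k hjk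
  have hfirst : ∀ j, pderiv j Y = 0 := by
    intro j
    have h := (hY.pderiv (i := j)).sum_X_mul_pderiv
    simp only [hsecond, mul_zero, Finset.sum_const_zero] at h
    simpa using h.symm
  have h := hY.sum_X_mul_pderiv
  simp only [hfirst, mul_zero, Finset.sum_const_zero] at h
  have h2 : (2 : ℕ) • Y = 0 := h.symm
  exact (smul_eq_zero.mp h2).resolve_left (by norm_num)

/-! ## `D`-killed polynomials are invariant under translation along `(1,1,1)` -/

/-- If `Σᵢ vᵢ ∂ᵢ p = 0` then `p` is constant along the direction `v`: `p(x + t v) = p(x)`. -/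
theorem toFun_add_smul_eq {n : ℕ} (p : MvPolynomial (Fin n) ℝ) (v : EuclideanSpace ℝ (Fin n))
    (hv : ∑ i, v i • pderiv i p = 0) (x : EuclideanSpace ℝ (Fin n)) (t : ℝ) : toFun p (x + t • v) = toFun p x := by
  set g : ℝ → ℝ := fun t => toFun p (x + t • v) with hg
  have hderiv : ∀ t, HasDerivAt g 0 t := by
    intro t
    have hγ : HasDerivAt (fun t : ℝ => x + t • v) v t := by
      simpa using ((hasDerivAt_id t).smul_const v).const_add x
    have h := (hasFDerivAt_toFun p (x + t • v)).comp_hasDerivAt t hγ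
    have h0 : Literature.Analysis.Calculus.MvPoly.derivCLM p (x + t • v) v = 0 := by
      rw [derivCLM_apply]
      have := congrArg (fun q => toFun q (x + t • v)) hv
      simp only [Literature.Analysis.Calculus.MvPoly.toFun_sum, Literature.Analysis.Calculus.MvPoly.toFun_smul,
        Literature.Analysis.Calculus.MvPoly.toFun_zero] at this
      exact this
    rw [h0] at h
    exact h
  have hconst := is_const_of_deriv_eq_zero (fun t => (hderiv t).differentiableAt) (fun t => (hderiv t).deriv) t 0
  simpa [hg] using hconst

/-- Evaluation form: if `D p = 0` (`D = Σᵢ ∂ᵢ`) then `p (x + t(1,1,1)) = p x`. -/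
theorem eval_add_const_eq (p : P3) (hD : ∑ i, pderiv i p = 0) (x : Fin 3 → ℝ) (t : ℝ) :
    eval (fun i => x i + t) p = eval x p := by
  have hv : ∑ i, (WithLp.toLp 2 (fun _ : Fin 3 => (1 : ℝ)) : EuclideanSpace ℝ (Fin 3)) i • pderiv i p = 0 := by
    simpa using hD
  have h := toFun_add_smul_eq p (WithLp.toLp 2 fun _ => (1 : ℝ)) hv (WithLp.toLp 2 x) t
  simp only [Literature.Analysis.Calculus.MvPoly.toFun_apply] at h
  have e1 : (fun i => (WithLp.toLp 2 x + t • WithLp.toLp 2 (fun _ : Fin 3 => (1 : ℝ)) : EuclideanSpace ℝ (Fin 3)) i) =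
      fun i => x i + t := by
    funext i; simp
  have e2 : (fun i => (WithLp.toLp 2 x : EuclideanSpace ℝ (Fin 3)) i) = x := by
    funext i; simp
  rw [e1, e2] at h
  exact h

/-- If `D p = 0` then `p ∘ Pm = p` (`Pm` = orthogonal projection onto the plane `x₁+x₂+x₃ = 0`). -/
theorem bind₁_Pm_eq_self (p : P3) (hD : ∑ i, pderiv i p = 0) : bind₁ (linSubst Pm) p = p := by
  refine MvPolynomial.funext fun x => ?_
  rw [eval_bind₁_linSubst, Pm_mulVec]
  have h := eval_add_const_eq p hD x (-(1 / 3 * (x 0 + x 1 + x 2)))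
  simpa [sub_eq_add_neg] using h


/-! ## Small facts used by the induction -/

/-- `η'(ψ) = (2d+1)⁻¹ · η(ψ)`. -/
theorem eta'_eq (ψ : P3) (d : ℕ) :
    ((∑ i, X i) * ψ - (2 * (d : ℝ) + 1)⁻¹ • (rho * ∑ i, pderiv i ψ) : P3) =
      (2 * (d : ℝ) + 1)⁻¹ • ((2 * (d : ℝ) + 1) • ((∑ i, X i) * ψ) - rho * ∑ i, pderiv i ψ) := by
  have hd : (2 * (d : ℝ) + 1) ≠ 0 := by positivity
  rw [smul_sub, smul_smul, inv_mul_cancel₀ hd, one_smul]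

/-- `η'(ψ)` is harmonic for `ψ` harmonic homogeneous of degree `d`. -/
theorem lap_eta'_eq_zero {ψ : P3} {d : ℕ} (hψ : ψ.IsHomogeneous d) (hharm : lap ψ = 0) :
    lap ((∑ i, X i) * ψ - (2 * (d : ℝ) + 1)⁻¹ • (rho * ∑ i, pderiv i ψ)) = 0 := by
  rw [eta'_eq, lap_smul, lap_eta_eq_zero hψ hharm, smul_zero]

/-- `η'(ψ)` is homogeneous of degree `d + 1`. -/
theorem isHomogeneous_eta' {ψ : P3} {d : ℕ} (hψ : ψ.IsHomogeneous d) :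
    ((∑ i, X i) * ψ - (2 * (d : ℝ) + 1)⁻¹ • (rho * ∑ i, pderiv i ψ) : P3).IsHomogeneous (d + 1) := by
  rw [eta'_eq, smul_eq_C_mul]
  simpa using (isHomogeneous_C _ ((2 * (d : ℝ) + 1)⁻¹)).mul (isHomogeneous_eta hψ)

/-- `Rf` commutes with the coordinate permutations (pointwise). -/
theorem Rf_mulVec_comp_perm (σ : Equiv.Perm (Fin 3)) (x : Fin 3 → ℝ) : Rf.mulVec (x ∘ σ) = Rf.mulVec x ∘ σ := by
  have hs : x (σ 0) + x (σ 1) + x (σ 2) = x 0 + x 1 + x 2 := by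
    have h := Equiv.sum_comp σ x
    simp only [Fin.sum_univ_three] at h
    exact h
  funext i
  simp only [Rf_mulVec, Function.comp_apply, hs]

/-- `rename σ` commutes with the substitution by `Rf`. -/
theorem rename_bind₁_Rf (σ : Equiv.Perm (Fin 3)) (p : P3) :
    rename σ (bind₁ (linSubst Rf) p) = bind₁ (linSubst Rf) (rename σ p) := by
  refine MvPolynomial.funext fun x => ?_
  rw [eval_rename, eval_bind₁_linSubst, eval_bind₁_linSubst, eval_rename, Rf_mulVec_comp_perm]

/-- `Rf` fixes the plane `x₁+x₂+x₃ = 0` pointwise, in particular the image of `Pm`. -/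
theorem Rf_mulVec_Pm_mulVec (x : Fin 3 → ℝ) : Rf.mulVec (Pm.mulVec x) = Pm.mulVec x := by
  rw [Rf_mulVec_eq_σ₁]
  exact Summit.QuantumFields.YangMills.Theorems.F4SubCurvatureDoorTwoReflections.σ₁_of_sum_eq_zero
    (Summit.QuantumFields.YangMills.Theorems.F4SubCurvatureDoorTrigonalLine.Pm_mulVec_sum x)

/-- `s = Σᵢ Xᵢ ≠ 0` in `P3`. -/
theorem sum_X_ne_zero : (∑ i, X i : P3) ≠ 0 := by
  intro h
  have h1 := congrArg (eval fun _ : Fin 3 => (1 : ℝ)) h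
  simp [Fin.sum_univ_three] at h1
  norm_num at h1

/-- The ladder coefficient `κ = 2j(2j+2d+2)(2d+1)⁻¹ + 1` is positive. -/
theorem kappa_pos (j d : ℕ) : 0 < 2 * (j : ℝ) * (2 * j + 2 * d + 2) * (2 * (d : ℝ) + 1)⁻¹ + 1 := by positivity


end Summit.QuantumFields.YangMills.Theorems.F4SubCurvatureDoorTorus

end
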